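import Literature.AnabelianGeometry.EtaleTheta.Discharge.Sec4GaloisSwapToy
import Literature.AnabelianGeometry.EtaleTheta.Discharge.Sec4Prop43iHolds
import HarnessLib

/-!
# [EtTh] §4: the Galois-swap toy, part 2 — two non-natural Galois representatives, the setting, a
# `1`-st root, and `¬ ∀ S, Prop43_i` (FACT-LIST row F-0492 AS TYPED is a schema; its residual input is
# exactly the naturality law `GaloisSurjNatural`)

S. Mochizuki, *The étale theta function and its Frobenioid-theoretic manifestations*, Publ. RIMS **45**
(2009) [MochizukiEtTh2009], §4: Def. 4.1 (PDF pp.86–87), Prop. 4.2 (iii) p.88, Prop. 4.3 (i) p.90 and its proof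
p.91: «… it suffices … to prove that `Div(s'_N)`, `Div(s''_N)` are fixed by `H_{A_N}`. But since `N · Div(s'_N)`,
`N · Div(s''_N)` arise as pull-backs to `A_N` of elements of `Φ(A_⊙)`, this follows from the fact that `H_⊙` acts
trivially on `A_⊙^bs`.»

abc-iut cell, block F, seat abc-iut-f-111 (row F-0492, the ¬∀ half).  Sequel of `Discharge/Sec4GaloisSwapToy.lean`
(base `D`: two isomorphic objects `Y`, `Y′` with `Aut = ℤ/2`; `Φ = (ℚ_{≥0})²` with the swap action; tempered-Frobenioid
interface `ToySwap.tf`).  This file (its `def`s are toy OBJECTS; no `Prop`-valued definition, no named fact, no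
instance) builds over it:
* `Π^tp_X` := abc-iut-w5-d218's inhabitant of the [EtTh] §1 interface over `ℚ̄` and a surjection
  `Π^tp_X ↠ (ℤ/2)²` (`exists_surjective_pair`) from the interface's OWN fields — `G_ℚ̄ = 1`, so `Δ^tp = Π^tp` and
  `Δ̂ = Π̂` is free profinite on two generators (`deltaHat_free`), and `Π^tp → Π̂` is dense
  (`isProfiniteCompletion_toHat`); the two Galois representatives `galoisSurj Y := pr₁`, `galoisSurj Y′ := pr₂`
  (Def. 4.1 (ii) typed: ONE representative per Galois object, no naturality) — both onto `Aut_D(−) = ℤ/2`, and some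
  `g ∈ Π^tp_X` acts trivially on `Y` but by the swap `σ` on `Y′ ≅ Y` (`exists_galoisSurj_Y_eq_one_and_Y'_eq_σ`);
* the §4 setting `ToySwap.S := BiKummerSetting.mk …` with FREE, TRIVIAL birational vocabulary (as abc-iut-f-111's
  `ToyGal.S`, p433015: `O^×(A^birat) := 1`, `fracOf := 1`; `DisjointSupports` / `(N,H)` / base-Frobenius-pair slots
  `:= True`), `A_⊙ := (Y, 0)` — so `H_⊙ = Ker(pr₁)` and `H_A^bs = pr₂(Ker pr₁) = Aut_D(Y′)` for `A := (Y′, 0) ≅ A_⊙`;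
* the endomorphic pre-step `s′ = step := (1, id, 𝔭₁, u)` of `A` (zero divisor the FIRST prime), the fraction-pair
  `(s′, s′)`, its trivial `1`-st root `nthRoot` (`α = β = id`, `G = 1`; Def. 4.1 (ii)–(iv) REAL clauses checked:
  Frobenius-trivial, `μ_1`-saturated, pull-back morphism, `H_⊙`-ample), and the lift `h₀ := (1, σ, 0, 0) ∈ H_A`;
* **`not_prop43_i` / `not_forall_prop43_i`**: for the trivializing SECTION `s^triv :=` the inclusion
  `H_A ↪ Aut_C(A)` and `ident := id`, a bi-Kummer root would give `σ′ ∈ Aut_C(A)` with `σ′ ∘ s′ = s′ ∘ h₀`; reading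
  zero divisors, `Div(σ′) + 𝔭₁ = σ^*𝔭₁ = 𝔭₂` in `(ℚ_{≥0})²`, impossible — so the `∃!` clause of abc-iut-L2-t3's typed
  `BiKummerSetting.Prop43_i` FAILS, and its universal closure is FALSE;
* **`not_galoisSurjNatural`**: with abc-iut-f-109's `prop43_i_of_galoisSurjNatural'` (p438088: for EVERY setting
  and transport, `GaloisSurjNatural → Prop43_i`) the toy violates `GaloisSurjNatural` in kernel — an INDEPENDENCE
  certificate: the typed Prop. 4.3 (i) is decided exactly by the owner-named naturality law of Def. 4.1 (ii) («outer»),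
  which the hypothesis structure `BiKummerSetting` does not carry and print supplies.
HONEST FRAMING: a statement about the TYPED interface (FACT-LIST row F-0492 is admissible per NAMED instance / via
`GaloisSurjNatural` only); it says nothing about print's Prop. 4.3 (i), whose hypothesis IS the naturality; no side
taken on [IUTchIII] Cor. 3.12; typed ≠ proved.
-/

noncomputable section

namespace Literature.AnabelianGeometry.EtaleTheta

open CategoryTheory Opposite Literature.AlgebraicGeometry.Frobenioids
open scoped NNRat

namespace ToySwap

/-! ## `Π^tp_X` over `ℚ̄` and a surjection `Π^tp_X ↠ (ℤ/2)²` from the [EtTh] §1 interface -/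

/-- `Π^tp_X ↠ G_K` of the toy: abc-iut-w5-d218's inhabitant of `OncePuncturedTemperedGroup ℚ̄`.
[cite: MochizukiEtTh2009, §1 p.238] -/
def oncePunctured : SemiGraphs.OncePuncturedTemperedGroup Toy.Kbar :=
  (SemiGraphs.OncePuncturedTemperedGroup.nonempty_model_of_isAlgClosed Toy.Kbar).some

/-- Its underlying `TemperedArithmeticGroup`. [cite: MochizukiSemiAnbd2006, Ex 3.10 p.43] -/
abbrev temperedGroup : SemiGraphs.TemperedArithmeticGroup.{0} Toy.Kbar := oncePunctured.toTemperedArithmeticGroup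

/-- The group `(ℤ/2)²` (target of the two Galois representatives of the toy). [cite: MochizukiEtTh2009, Def 4.1 p.87] -/
abbrev G2 : Type := G × G

/-- **`Π^tp_X ↠ (ℤ/2)²`** for every inhabitant `X` of the [EtTh] §1 interface over an algebraically closed
field: `G_K = 1`, so `Δ^tp_X = Π^tp_X` and `Δ̂ = Π̂`; `Δ̂` is free profinite on two generators `x₀, x₁`
(`deltaHat_free`), whence a continuous `Δ̂ → (ℤ/2)²` with `x₀ ↦ (σ,1)`, `x₁ ↦ (1,σ)`; it is onto, and since
`Π^tp_X → Π̂` has dense image (`isProfiniteCompletion_toHat`) and `(ℤ/2)²` is discrete, the composite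
`Π^tp_X → (ℤ/2)²` is onto as well. [cite: MochizukiEtTh2009, §1 p.238] -/
theorem exists_surjective_pair (X : SemiGraphs.OncePuncturedTemperedGroup Toy.Kbar) :
    ∃ π : X.Pi →* G2, Function.Surjective π := by
  classical
  -- `G_ℚ̄ = 1`
  haveI : Subsingleton (Field.absoluteGaloisGroup Toy.Kbar) := by
    refine ⟨fun s t => AlgEquiv.ext fun x => ?_⟩
    obtain ⟨k, rfl⟩ :=
      (IsAlgClosed.algebraMap_bijective_of_isIntegral (k := Toy.Kbar) (K := AlgebraicClosure Toy.Kbar)).2 x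
    rw [AlgEquiv.commutes, AlgEquiv.commutes]
  -- the closed subgroup `Δ̂ ⊆ Π̂` and the map `Π → Δ̂`
  set H : Subgroup X.PiHat := (X.aug.toMonoidHom.ker.map X.toHat.toMonoidHom).topologicalClosure with hH
  have hmem : ∀ g : X.Pi, X.toHat g ∈ H := fun g =>
    Subgroup.le_topologicalClosure _ (Subgroup.mem_map_of_mem X.toHat.toMonoidHom
      (show g ∈ X.aug.toMonoidHom.ker from by rw [MonoidHom.mem_ker]; exact Subsingleton.elim _ _))
  let ι : X.Pi →* H := X.toHat.toMonoidHom.codRestrict H hmem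
  -- the free property of `Δ̂`
  obtain ⟨x, hx⟩ := X.deltaHat_free
  letI : TopologicalSpace G2 := ⊥
  haveI : DiscreteTopology G2 := ⟨rfl⟩
  obtain ⟨f, hf, -⟩ := hx G2 (fun i => if i = 0 then (σ, 1) else (1, σ))
  have hf0 : f (x 0) = (σ, 1) := by rw [hf 0, if_pos rfl]
  have hf1 : f (x 1) = (1, σ) := by rw [hf 1, if_neg (by decide)]
  refine ⟨f.toMonoidHom.comp ι, fun y => ?_⟩
  -- a preimage of `y` in `Δ̂`
  obtain ⟨z, hz⟩ : ∃ z : H, f z = y := by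
    obtain ⟨a, b⟩ := y
    obtain ⟨z₁, hz₁⟩ : ∃ z : H, f z = (a, 1) := by
      rcases eq_one_or_eq_σ a with rfl | rfl
      · exact ⟨1, by rw [map_one]; rfl⟩
      · exact ⟨x 0, hf0⟩
    obtain ⟨z₂, hz₂⟩ : ∃ z : H, f z = (1, b) := by
      rcases eq_one_or_eq_σ b with rfl | rfl
      · exact ⟨1, by rw [map_one]; rfl⟩
      · exact ⟨x 1, hf1⟩
    exact ⟨z₁ * z₂, by rw [map_mul, hz₁, hz₂, Prod.mk_mul_mk, mul_one, one_mul]⟩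
  -- density of `Π` in `Δ̂ = Π̂`
  have hdense : DenseRange ι := by
    rw [DenseRange, Topology.IsInducing.subtypeVal.dense_iff]
    intro h
    have key : (h : X.PiHat) ∈ closure (Set.range X.toHat) := by
      rw [X.isProfiniteCompletion_toHat.denseRange.closure_range]
      exact Set.mem_univ _
    convert key using 2
    ext q
    simp only [Set.mem_image, Set.mem_range]
    constructor
    · rintro ⟨_, ⟨g, rfl⟩, rfl⟩
      exact ⟨g, rfl⟩
    · rintro ⟨g, rfl⟩
      exact ⟨ι g, ⟨g, rfl⟩, rfl⟩
  obtain ⟨g, hg⟩ := hdense.exists_mem_open ((isOpen_discrete {y}).preimage (map_continuous f)) ⟨z, hz⟩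
  exact ⟨g, hg⟩

/-- A chosen surjection `Π^tp_X ↠ (ℤ/2)²` of the toy. [cite: MochizukiEtTh2009, Def 4.1 p.87] -/
def piQuot : temperedGroup.Pi →* G2 := (exists_surjective_pair oncePunctured).choose

/-- `piQuot` is surjective. [cite: MochizukiEtTh2009, Def 4.1 p.87] -/
theorem piQuot_surjective : Function.Surjective piQuot := (exists_surjective_pair oncePunctured).choose_spec

/-- The coordinate of `(ℤ/2)²` read at a base object: `pr₁` at `Y`, `pr₂` at `Y′`. [cite: MochizukiEtTh2009, Def 4.1 p.87] -/
def coord (A : Base) : G2 →* G := cond A (MonoidHom.snd G G) (MonoidHom.fst G G)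

/-- `coord Y = pr₁`. [cite: MochizukiEtTh2009, Def 4.1 p.87] -/
theorem coord_Y : coord Y = MonoidHom.fst G G := rfl

/-- `coord Y′ = pr₂`. [cite: MochizukiEtTh2009, Def 4.1 p.87] -/
theorem coord_Y' : coord Y' = MonoidHom.snd G G := rfl

/-- Each coordinate `(ℤ/2)² → ℤ/2 = Aut_D(−)` is surjective. [cite: MochizukiEtTh2009, Def 4.1 p.87] -/
theorem coord_surjective (A : Base) : Function.Surjective (coord A) := by
  intro g
  cases A
  · exact ⟨(g, 1), rfl⟩
  · exact ⟨(1, g), rfl⟩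

/-- **The two NON-natural Galois representatives** `Π^tp_X ↠ Aut_D(A)` (Def 4.1 (ii): one representative per
Galois object, as the typed setting allows): the first coordinate of `piQuot` at `Y`, the second at `Y′`.
[cite: MochizukiEtTh2009, Def 4.1 p.87] -/
def galoisSurj (A : Base) (_ : True) : temperedGroup.Pi →* Aut A := (autOf A).comp ((coord A).comp piQuot)

/-- Each representative is surjective onto `Aut_D(A) = ℤ/2`. [cite: MochizukiEtTh2009, Def 4.1 p.87] -/
theorem galoisSurj_surjective (A : Base) (h : True) : Function.Surjective (galoisSurj A h) :=
  (autOf_surjective A).comp ((coord_surjective A).comp piQuot_surjective)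

/-- **The failure of naturality, concretely**: some `g ∈ Π^tp_X` acts trivially on `Y` (so `g ∈ H_⊙` once
`A_⊙^bs = Y`) but by the swap `σ` on `Y′ ≅ Y`. [cite: MochizukiEtTh2009, Def 4.1 p.87] -/
theorem exists_galoisSurj_Y_eq_one_and_Y'_eq_σ :
    ∃ g : temperedGroup.Pi, galoisSurj Y trivial g = 1 ∧ galoisSurj Y' trivial g = autOf Y' σ := by
  obtain ⟨g, hg⟩ := piQuot_surjective (1, σ)
  refine ⟨g, ?_, ?_⟩
  · change autOf Y (coord Y (piQuot g)) = 1
    rw [hg]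
    exact map_one (autOf Y)
  · change autOf Y' (coord Y' (piQuot g)) = autOf Y' σ
    rw [hg]
    rfl

/-! ## The §4 setting with free (trivial) birational vocabulary, `A_⊙ := (Y, 0)` -/

/-- **The toy §4 setting**: the tempered-Frobenioid interface `tf` with the BIRATIONAL VOCABULARY FREE AND TRIVIAL
(`O^×(A^birat) := 1`, `fracOf := 1`, trivial `Aut`-action; `DisjointSupports`, `(N,H)`-saturation, base-Frobenius-pair
slots `:= True`), the two non-natural Galois representatives `galoisSurj`, all objects Galois, `A_⊙ := (Y, 0)`.
[cite: MochizukiEtTh2009, Def 4.1 p.86] -/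
def S : BiKummerSetting temperedGroup realified Base catVocab where
  tf := tf
  monoidType_eq := tf_monoidType
  isPerfect := tf_isPerfect
  DisjointSupports _ _ := True
  biratUnits _ := PUnit
  biratAut _ := 1
  restrictAlong _ _ := MulEquiv.refl _
  fracOf _ _ _ _ _ := PUnit.unit
  IsGaloisObj _ := True
  galoisSurj := galoisSurj
  galoisSurj_surjective := galoisSurj_surjective
  IsNHSaturatedBsFld _ _ _ := True
  ArisesFromBaseFrobeniusPair _ _ _ := True
  Aodot := ModelFrobenioid.zeroObj _ _ _ Y
  isFrobeniusTrivial_Aodot := ModelFrobenioid.isFrobeniusTrivial_zeroObj ratFnFunctor_isGroupLike _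
  isGalois_Aodot := trivial

/-- `B` of the setting is objectwise group-like. [cite: MochizukiEtTh2009, Def 3.6 p.77] -/
theorem S_ratFnFunctor_isGroupLike : Objectwise (fun N _ => IsGroupLike N) S.tf.ratFnFunctor :=
  ratFnFunctor_isGroupLike

/-! ## The object `A := (Y′, 0) ≅ A_⊙`, the pre-step `s′ = (1, id, 𝔭₁, u)` and the fraction-pair `(s′, s′)` -/

/-- `A := (Y′, 0)`, the domain (and codomain, and `1`-domain) of the fraction-pair. [cite: MochizukiEtTh2009, Prop 4.2 p.88] -/
def A : S.C := ModelFrobenioid.zeroObj _ _ _ Y'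

/-- `A ≅ A_⊙`: the zero section applied to `Y′ ≅ Y`. [cite: MochizukiEtTh2009, Prop 4.3 p.90] -/
def isoAodot : A ≅ S.Aodot :=
  (ModelFrobenioid.zeroSection S.tf.divisorMonoid S.tf.ratFnFunctor S.tf.divBNatTrans).mapIso
    { hom := homOf Y' Y 1
      inv := homOf Y Y' 1
      hom_inv_id := InducedCategory.hom_ext (show ((1 : G) * 1 : G) = 1 from mul_one 1)
      inv_hom_id := InducedCategory.hom_ext (show ((1 : G) * 1 : G) = 1 from mul_one 1) }

/-- The divisor `𝔭₁ = (1, 0) ∈ (ℚ_{≥0})² = Φ(Y′)`. [cite: MochizukiEtTh2009, Def 4.1 p.86] -/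
def pdiv : S.tf.divisorMonoid.obj (op A.base) := ⟨((Multiplicative.ofAdd (1 : ℚ≥0), 1) : M), trivial⟩

/-- The rational function `u ∈ B(Y′)` with divisor `𝔭₁` (all divisors are principal in the toy).
[cite: MochizukiEtTh2009, Def 3.6 p.77] -/
def ratFnP : S.tf.ratFnFunctor.obj (op A.base) :=
  ⟨(Algebra.GrothendieckGroup.of (M := M) (Multiplicative.ofAdd (1 : ℚ≥0), 1), Algebra.GrothendieckGroup.of pdiv), by
    change Algebra.GrothendieckGroup.of (M := M) (Multiplicative.ofAdd (1 : ℚ≥0), 1) =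
      gpMap _ (Algebra.GrothendieckGroup.of pdiv)
    rw [gpMap_of]
    rfl⟩

/-- The base-identity pre-step `s′ := (1, id, 𝔭₁, u) : A → A`. [cite: MochizukiEtTh2009, Def 4.1 p.86] -/
def step : A ⟶ A :=
  ModelFrobenioid.mkHom A A 1 (𝟙 _) pdiv ratFnP (by
    show (1 : Algebra.GrothendieckGroup (S.tf.divisorMonoid.obj (op A.base))) ^ ((1 : ℕ+) : ℕ) *
        Algebra.GrothendieckGroup.of pdiv =
      pullGp S.tf.divisorMonoid (𝟙 A.base) 1 * Algebra.GrothendieckGroup.of pdiv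
    rw [one_pow, map_one])

/-- `step` is a pre-step. [cite: MochizukiEtTh2009, Def 4.1 p.86] -/
theorem isPreStep_step : S.IsPreStep step :=
  ⟨rfl, show IsIso (𝟙 A.base) from inferInstance⟩

/-- **Def 4.1 (i) at the toy**: `(s′, s″) := (step, step)` is a fraction-pair for `f = 1 ∈ O^×(A^birat) = 1`
(free vocabulary: disjointness of supports is the free slot). [cite: MochizukiEtTh2009, Def 4.1 p.86] -/
def fractionPair : S.FractionPair (A := A) PUnit.unit A where
  num := step
  den := step
  isPreStep_num := isPreStep_step
  isPreStep_den := isPreStep_step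
  base_eq := rfl
  frac_eq := rfl
  disjointSupports := trivial

/-! ## `H_A`, ampleness, and the `1`-st root -/

/-- Lifting `Aut_D(Y′)` to `Aut_C(A)` through the zero section `(1, g, 0, 1)`. [cite: MochizukiEtTh2009, Def 4.1 p.87] -/
def liftAut (β : Aut (Y' : Base)) : Aut A :=
  (ModelFrobenioid.zeroSection S.tf.divisorMonoid S.tf.ratFnFunctor S.tf.divBNatTrans).mapIso β

/-- `Base(liftAut β) = β`. [cite: MochizukiEtTh2009, Def 4.1 p.87] -/
theorem autBase_liftAut (β : Aut (Y' : Base)) : S.autBase A (liftAut β) = β := Iso.ext rfl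

/-- `A` is `H_⊙`-ample: every element of `Aut_D(Y′)` lifts. [cite: MochizukiEtTh2009, Def 4.1 p.87] -/
theorem isAmple_A : S.IsAmple A :=
  ⟨trivial, fun β _ => ⟨liftAut β, autBase_liftAut β⟩⟩

/-- `A` is `μ_1`-saturated (`μ_1 = 1`). [cite: MochizukiEtTh2009, Def 4.1 p.87] -/
theorem isMuSaturated_A_one : S.IsMuSaturated A 1 := by
  refine ⟨1, ⟨one_mem _, by rw [PNat.one_coe, pow_one]⟩, by rw [orderOf_one, PNat.one_coe], ?_⟩
  rintro τ ⟨-, hτ⟩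
  rw [PNat.one_coe, pow_one] at hτ
  rw [hτ]
  exact one_mem _

/-- **Def 4.1 (iv) at the toy**: `id : A → A` is of base-Frobenius type with `G = 1`, `α′ = α″ = id`
(`Gal(A^bs/A^bs) = 1`; (e) is the free slot). [cite: MochizukiEtTh2009, Def 4.1 p.87] -/
def baseFrobeniusTypeDataId : S.BaseFrobeniusTypeData (𝟙 A) where
  G := ⊥
  G_le := bot_le
  α₂ := 𝟙 _
  α₁ := 𝟙 _
  fac := Category.comp_id _
  isFrobeniusTrivial := ModelFrobenioid.isFrobeniusTrivial_zeroObj S_ratFnFunctor_isGroupLike _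
  isGalois := trivial
  isMuSaturated := isMuSaturated_A_one
  mapsIsomorphically := by
    refine ⟨fun τ hτ => ?_, fun τ hτ τ' hτ' _ => ?_, fun τ hτ => ⟨1, (⊥ : Subgroup (Aut A)).one_mem, ?_⟩⟩
    · have hτ1 : τ = 1 := hτ
      subst hτ1
      rw [map_one]
      exact one_mem _
    · exact (show τ = 1 from hτ).trans (show τ' = 1 from hτ').symm
    · have h : τ.hom ≫ ModelFrobenioid.baseMap (𝟙 A) = ModelFrobenioid.baseMap (𝟙 A) := hτ
      rw [ModelFrobenioid.baseMap_id, Category.comp_id] at h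
      rw [map_one]
      exact (Iso.ext h).symm
  cond_c := ⟨rfl, ⟨ModelFrobenioid.isCoAngular S_ratFnFunctor_isGroupLike _, rfl⟩,
    show IsIso (𝟙 (ModelFrobenioid.base A)) from inferInstance⟩
  cond_d := PreFrobenioid.isPullbackMorphism_of_isIso S.F (𝟙 A)
  cond_e := trivial

/-- **Prop 4.2 (iii) data at the toy**: the fraction-pair `(s′, s′)` is its own `1`-st root (`A_1 = B_1 = A`,
`α = β = id`, free root `f_1 = 1`), for the trivial transport `pullFrac := id`. [cite: MochizukiEtTh2009, Prop 4.2 p.88] -/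
def nthRoot : S.NthRoot (A := A) PUnit.unit fractionPair 1 (fun {_} _ x => x) where
  AN := A
  BN := A
  α := 𝟙 _
  β := 𝟙 _
  root := PUnit.unit
  pair := fractionPair
  comm_num := by rw [Category.comp_id, Category.id_comp]
  comm_den := by rw [Category.comp_id, Category.id_comp]
  isIsometry := ⟨ModelFrobenioid.isIsometry_id _, ModelFrobenioid.isIsometry_id _, rfl, rfl⟩
  αData := baseFrobeniusTypeDataId
  pow_root := rfl
  isSaturated :=
    { isAmple := isAmple_A
      fixed := fun _ _ => rfl
      cond_a := ⟨A, A, 𝟙 _, 𝟙 _, ModelFrobenioid.isPreStep_id _, ModelFrobenioid.isPreStep_id _,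
        ModelFrobenioid.isFrobeniusTrivial_zeroObj S_ratFnFunctor_isGroupLike _, trivial⟩
      cond_b := ⟨PUnit.unit, rfl⟩ }

/-- The swap `σ ∈ Aut_D(Y′)` lifted to `Aut_C(A)`: `h₀ := (1, σ, 0, 0)`. [cite: MochizukiEtTh2009, Def 4.1 p.87] -/
def h₀ : Aut A := liftAut (autOf Y' σ)

/-- **The non-naturality at work**: `h₀ ∈ H_A` — its base `σ` lies in `H_A^bs = pr₂(H_⊙)`, `H_⊙ = Ker(pr₁)`,
although «`H_⊙` acts trivially on `A_⊙^bs`» and `A ≅ A_⊙`. [cite: MochizukiEtTh2009, Prop 4.3 p.91] -/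
theorem h₀_mem : h₀ ∈ S.HA A trivial := by
  obtain ⟨g, hg₁, hg₂⟩ := exists_galoisSurj_Y_eq_one_and_Y'_eq_σ
  change S.autBase A h₀ ∈ S.HAbs A trivial
  exact ⟨g, MonoidHom.mem_ker.2 hg₁, hg₂.trans (autBase_liftAut (autOf Y' σ)).symm⟩

/-! ## The refutation -/

/-- Zero divisors, first prime: `Div(τ ∘ s′)₁ = Div(τ)₁ + deg_Fr(τ)·1` (the base of `s′` is the identity, which
acts trivially on `Φ`). [cite: MochizukiFrdI2008, Thm. 5.2(i) p.100] -/
theorem fst_div_step_comp (τ : A ⟶ A) :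
    ((ModelFrobenioid.div (step ≫ τ)).1 : M).1 =
      ((ModelFrobenioid.div τ).1 : M).1 * Multiplicative.ofAdd (1 : ℚ≥0) ^ (ModelFrobenioid.degFr τ : ℕ) := by
  show (act (1 : G) ((ModelFrobenioid.div τ).1 : M) *
      ((Multiplicative.ofAdd (1 : ℚ≥0), (1 : Multiplicative ℚ≥0)) : M) ^ (ModelFrobenioid.degFr τ : ℕ)).1 = _
  rw [act_one]
  rfl

/-- Zero divisors, first prime: `Div(s′ ∘ h₀)₁ = (σ^*𝔭₁)₁ = (𝔭₂)₁ = 0` — the base automorphism `σ` of `h₀ ∈ H_A`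
MOVES the zero divisor of `s′`. [cite: MochizukiEtTh2009, Prop 4.3 (i) p.91] -/
theorem fst_div_h₀_comp_step : ((ModelFrobenioid.div (h₀.hom ≫ step)).1 : M).1 = 1 := by
  show (act σ ((Multiplicative.ofAdd (1 : ℚ≥0), (1 : Multiplicative ℚ≥0)) : M) *
      (1 : M) ^ ((1 : ℕ+) : ℕ)).1 = 1
  rw [act_σ, swapHom_apply, one_pow, mul_one]

/-- **[EtTh] Prop 4.3 (i) AS TYPED fails at the toy setting `ToySwap.S`** (transport `id`): for the `1`-st root
`nthRoot`, the trivializing section `s^triv :=` the inclusion `H_A ↪ Aut_C(A)` and the identification `id`, no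
bi-Kummer root exists — a section `s′^{gp}` would give `σ′ ∘ s′ = s′ ∘ h₀`, whose zero divisors read
`Div(σ′) + 𝔭₁ = σ^*𝔭₁ = 𝔭₂` in `(ℚ_{≥0})²`. What fails is «`Div(s'_N)` fixed by `H_{A_N}`», i.e. the naturality of
the Galois surjections along `A^bs → A_⊙^bs`. [cite: MochizukiEtTh2009, Prop 4.3 (i) p.90] -/
theorem not_prop43_i : ¬ S.Prop43_i (fun {_ _} _ x => x) := by
  intro h
  obtain ⟨-, ⟨K, hKs, -, -, -⟩, -⟩ :=
    (h nthRoot trivial trivial (S.HA A trivial).subtype (fun _ => rfl) (MulEquiv.refl _) (fun g => by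
      change 𝟙 _ ≫ S.base.map g.1.hom = S.base.map g.1.hom ≫ 𝟙 _
      rw [Category.id_comp, Category.comp_id]) ⟨isoAodot⟩).1
  have hc : step ≫ (K.sNum (K.ident ⟨h₀, h₀_mem⟩)).hom = h₀.hom ≫ step := by
    have hc₀ := K.comm_num ⟨h₀, h₀_mem⟩
    rw [hKs] at hc₀
    exact hc₀
  -- read the first prime of the zero divisors of `σ′ ∘ s′ = s′ ∘ h₀`
  have e : ((ModelFrobenioid.div (h₀.hom ≫ step)).1 : M).1 =
      ((ModelFrobenioid.div (K.sNum (K.ident ⟨h₀, h₀_mem⟩)).hom).1 : M).1 *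
        Multiplicative.ofAdd (1 : ℚ≥0) ^ (ModelFrobenioid.degFr (K.sNum (K.ident ⟨h₀, h₀_mem⟩)).hom : ℕ) := by
    rw [← hc]
    exact fst_div_step_comp _
  rw [fst_div_h₀_comp_step, ModelFrobenioid.degFr_eq_one_of_isIso (K.sNum (K.ident ⟨h₀, h₀_mem⟩)).hom,
    PNat.one_coe, pow_one] at e
  have e' := congrArg Multiplicative.toAdd e
  rw [toAdd_one, toAdd_mul, toAdd_ofAdd] at e'
  exact absurd e'.symm (ne_of_gt (add_pos_of_nonneg_of_pos zero_le zero_lt_one))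

/-- **[EtTh] Prop 4.3 (i) AS TYPED is a schema, not a fact: its universal closure is FALSE** (FACT-LIST row F-0492,
abc-iut-f-111). With abc-iut-f-109's `prop43_i_of_galoisSurjNatural'` (every setting: `GaloisSurjNatural → Prop43_i`)
this is an independence certificate: the typed row is admissible per NAMED instance / via the naturality law only.
[cite: MochizukiEtTh2009, Prop 4.3 (i) p.90] -/
theorem not_forall_prop43_i :
    ¬ ∀ {K : Type} [Field K] {X : SemiGraphs.TemperedArithmeticGroup.{0} K} {D₀ : Type} [Category.{0} D₀]
        {V : FrdIMonoidStub.{0}} {T : RealifiedDivisorMonoids (D₀ := D₀) V} {D : Type} [Category.{0} D]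
        {VD : FrdICatStub.{0, 0, 0} D} (S : BiKummerSetting X T D VD)
        (pullFrac : ∀ {A A' : S.C} (_ : A' ⟶ A), S.biratUnits A → S.biratUnits A'),
        Literature.AnabelianGeometry.EtaleTheta.BiKummerSetting.Prop43_i S pullFrac :=
  fun h => not_prop43_i (h S (fun {_ _} _ x => x))

/-- **The toy setting violates the naturality law `GaloisSurjNatural` of Def 4.1 (ii)** — in kernel, through
abc-iut-f-109's `prop43_i_of_galoisSurjNatural'`: so `GaloisSurjNatural` is exactly the residual input of the typed
Prop 4.3 (i) (it holds at the canonical models over the genuine temperoid, abc-iut-w5-d013).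
[cite: MochizukiEtTh2009, Def 4.1 (ii) p.87] -/
theorem not_galoisSurjNatural : ¬ S.GaloisSurjNatural :=
  fun hN => not_prop43_i (S.prop43_i_of_galoisSurjNatural' (fun {_ _} _ x => x) hN)

end ToySwap

end Literature.AnabelianGeometry.EtaleTheta

end
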